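import Summits.QuantumFields.YangMills.Theorems.FemtoCutoffLadderLocalWallCutBound
import Summits.QuantumFields.YangMills.Theorems.FemtoCutoffLadderSubOctaveBoundedUpStepDoor

/-!
# Route `FemtoCutoffLadder`, crux `LocalWallStep` (stmt-QuantumFields-26282): the eigenfunction-free cut bound for walled SECOND values —
# `s(Q') ≥ (√m − √(λ₀ε))²` from ONE admissible orthonormal trial PLANE of Rayleigh floor `m` and plane-uniform `Q'`-bad fraction `ε`

Seat `leafhand-qf-femtocutoffladder-2` g0 (2026-08-30), `--supports stmt-QuantumFields-26282`.  Companion of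
`FemtoCutoffLadderLocalWallCutBound` (the `t`-half).  After ✓`localWallStep_of_oneWallLowerBounds` (p793595) the second half of the registered
stub of 26282 is the per-step lower bound (S) `s Q ≤ e^{A/(β²N)/L} · s (Q ∪ {p₀})` for the walled min–max values
`s Q' = inf_φ sSup (rayleighSet (W Q' ∧ · ⊥ φ))`.  The parent crux's tool (`le_compressedSecond_of_eigen_pair_cut`) cuts an exact orthonormal
EIGEN-pair; walled problems have no eigenfunctions in the tree.  Here:

* §1 `l2` bookkeeping on a two-dimensional span (`l2_span_self`, `l2_span_left`; `UpStep.l2_smul_right'`, `indicator_add_smul` from the tree);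
* §2 ★ `le_compressedSecond_of_cut_pair` (any constraint `P` met by the cuts `1_T(af₁ + bf₂)`): if `f₁, f₂` are `l2`-orthonormal physical
  functions with physical cut-offs, every combination `f = af₁ + bf₂` has `⟨f,K_βf⟩ ≥ m‖f‖²` and cut-away mass `‖1_{Tᶜ}f‖² ≤ ε‖f‖²`
  (`ε < 1`, `λ₀ε ≤ m`), then `(√m − √(λ₀ε))² ≤ s_P` — for each constraint `φ` a non-trivial combination of the CUTS is `⊥ φ` (rank–nullity in
  the plane) and `le_sSup_rayleighSet_of_cut` bounds its Rayleigh quotient;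
* §3 ★ `le_walledSecond_of_cut_pair`: the wall-set instance (threshold `β^{κ−1}`, any wall set `Q'`, any lattice, `β > 0`).
So (S) follows from «an admissible near-optimal trial PLANE for `s Q` (walled max–min ≥ `e^{−A/(2β²NL)}`-fraction of the min–max value — the
walled spectral theorem, not in the tree) whose members put fraction `≤ ε` of their mass on ONE more κ-bad plaquette» — the plane version of the
one-plaquette rarity statement that carries the content of LINE g5-A.
HONEST FRAMING: fixed-lattice variational bookkeeping; no rarity bound and no walled spectral theorem is proved here.  R2b1 is a RECORD rung —
not infinite volume, not a mass gap, not Clay; no summit is proved by this file.  No definitions, no named facts, no `sorry`.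
[cite: ReedSimonIV1978, Thm. XIII.1]
-/

set_option autoImplicit false

noncomputable section

open MeasureTheory Filter Topology Real
open Literature.MathematicalPhysics.QuantumFieldTheory hiding SU2
open Literature.MathematicalPhysics.QuantumLattice

namespace Summit.QuantumFields.YangMills.Theorems.FemtoTransferGap.SFCompression

open OffTube

variable {L : ℕ} [NeZero L]

/-! ## §1 Bookkeeping on a two-dimensional span -/

/-- `‖af₁ + bf₂‖² = a² + b²` for an `l2`-orthonormal physical pair. [folklore] -/
theorem l2_span_self {f₁ f₂ : GaugeConfig 3 L SU2 → ℝ} (h₁ : IsPhys f₁) (h₂ : IsPhys f₂)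
    (hn₁ : l2 f₁ f₁ = 1) (hn₂ : l2 f₂ f₂ = 1) (horth : l2 f₁ f₂ = 0) (a b : ℝ) :
    l2 (a • f₁ + b • f₂) (a • f₁ + b • f₂) = a ^ 2 + b ^ 2 := by
  rw [l2_add_add (h₁.smul a) (h₂.smul b)]
  simp only [l2_smul_left, UpStep.l2_smul_right', hn₁, hn₂, horth]
  ring

/-- `⟨ag₁ + bg₂, φ⟩ = a⟨g₁,φ⟩ + b⟨g₂,φ⟩` (physical test functions). [folklore] -/
theorem l2_span_left {g₁ g₂ φ : GaugeConfig 3 L SU2 → ℝ} (h₁ : IsPhys g₁) (h₂ : IsPhys g₂) (hφ : IsPhys φ) (a b : ℝ) :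
    l2 (a • g₁ + b • g₂) φ = a * l2 g₁ φ + b * l2 g₂ φ := by
  rw [l2_add_left (h₁.smul a) (h₂.smul b) hφ, l2_smul_left, l2_smul_left]

/-! ## §2 The cut witness bound for a compressed SECOND value, from a trial plane -/

/-- ★ **`(√m − √(λ₀ε))² ≤ s_P` from ONE cut trial plane.**  `f₁, f₂` `l2`-orthonormal physical with physical cut-offs by `T`; every cut
`1_T(af₁ + bf₂)` satisfies `P`; plane Rayleigh floor `m (a² + b²) ≤ ⟨af₁+bf₂, K_β(af₁+bf₂)⟩`; plane-uniform cut-away mass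
`‖1_{Tᶜ}(af₁+bf₂)‖² ≤ ε (a² + b²)` with `ε < 1` and `λ₀ε ≤ m`.  Then the compressed second value is at least `(√m − √(λ₀ε))²` (`β ≥ 0`).
[cite: ReedSimonIV1978, Thm. XIII.1] -/
theorem le_compressedSecond_of_cut_pair {β : ℝ} (hβ : 0 ≤ β) {P : (GaugeConfig 3 L SU2 → ℝ) → Prop}
    {T : Set (GaugeConfig 3 L SU2)} {f₁ f₂ : GaugeConfig 3 L SU2 → ℝ} (h₁ : IsPhys f₁) (h₂ : IsPhys f₂)
    (hcut : ∀ f : GaugeConfig 3 L SU2 → ℝ, IsPhys f → IsPhys (T.indicator f) ∧ IsPhys (Tᶜ.indicator f))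
    (hP : ∀ a b : ℝ, P (T.indicator (a • f₁ + b • f₂)))
    (hn₁ : l2 f₁ f₁ = 1) (hn₂ : l2 f₂ f₂ = 1) (horth : l2 f₁ f₂ = 0) {m ε : ℝ}
    (hm : ∀ a b : ℝ, m * (a ^ 2 + b ^ 2) ≤ qform su2Rep β (a • f₁ + b • f₂) (a • f₁ + b • f₂))
    (hε : ∀ a b : ℝ, l2 (Tᶜ.indicator (a • f₁ + b • f₂)) (Tᶜ.indicator (a • f₁ + b • f₂)) ≤ ε * (a ^ 2 + b ^ 2))
    (hε1 : ε < 1) (hεm : topValue su2Rep L β * ε ≤ m) :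
    (Real.sqrt m - Real.sqrt (topValue su2Rep L β * ε)) ^ 2 ≤
      sInf {x : ℝ | ∃ φ : GaugeConfig 3 L SU2 → ℝ, IsPhys φ ∧
        x = sSup (rayleighSet su2Rep L β fun ψ => P ψ ∧ l2 ψ φ = 0)} := by
  refine le_compressedSecond P fun φ hφ => ?_
  -- the cuts of the basis and a non-trivial combination orthogonal to `φ`
  have hv₁ : IsPhys (T.indicator f₁) := (hcut f₁ h₁).1
  have hv₂ : IsPhys (T.indicator f₂) := (hcut f₂ h₂).1
  obtain ⟨a, b, hab, hortho⟩ : ∃ a b : ℝ, (a ≠ 0 ∨ b ≠ 0) ∧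
      a * l2 (T.indicator f₁) φ + b * l2 (T.indicator f₂) φ = 0 := by
    by_cases ha : l2 (T.indicator f₁) φ = 0 ∧ l2 (T.indicator f₂) φ = 0
    · exact ⟨1, 0, Or.inl one_ne_zero, by rw [ha.1, ha.2]; ring⟩
    · refine ⟨l2 (T.indicator f₂) φ, -l2 (T.indicator f₁) φ, ?_, by ring⟩
      rcases not_and_or.mp ha with h | h
      · exact Or.inr (neg_ne_zero.mpr h)
      · exact Or.inl h
  set f : GaugeConfig 3 L SU2 → ℝ := a • f₁ + b • f₂ with hfdef
  have hf : IsPhys f := (h₁.smul a).add (h₂.smul b)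
  have hv : IsPhys (T.indicator f) := (hcut f hf).1
  have hw : IsPhys (Tᶜ.indicator f) := (hcut f hf).2
  have hab2 : 0 < a ^ 2 + b ^ 2 := by
    rcases hab with ha | hb
    · have := sq_pos_of_ne_zero ha; nlinarith [sq_nonneg b]
    · have := sq_pos_of_ne_zero hb; nlinarith [sq_nonneg a]
  have hff : l2 f f = a ^ 2 + b ^ 2 := l2_span_self h₁ h₂ hn₁ hn₂ horth a b
  have hfpos : 0 < l2 f f := by rw [hff]; exact hab2
  have hvφ : l2 (T.indicator f) φ = 0 := by
    rw [hfdef, indicator_add_smul, l2_span_left hv₁ hv₂ hφ, hortho]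
  refine le_sSup_rayleighSet_of_cut hβ hf hv hw ⟨hP a b, hvφ⟩ hfpos ?_ ?_ hε1 hεm
  · rw [hff]; exact hm a b
  · rw [hff]; exact hε a b

/-! ## §3 The wall-set instance -/

/-- ★ **The walled cut bound for second values.**  For `β > 0`, any real `κ`, ANY wall set `Q'` and any `l2`-orthonormal physical pair
`f₁, f₂` whose span has Rayleigh floor `m` and puts fraction `≤ ε < 1` of its mass on «some plaquette of `Q'` is κ-bad» (plane-uniformly),
with `λ₀ε ≤ m`: `(√m − √(λ₀ε))² ≤ s Q' = inf_φ sSup (rayleighSet su2Rep L β (W Q' ∧ · ⊥ φ))`. [cite: ReedSimonIV1978, Thm. XIII.1] -/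
theorem le_walledSecond_of_cut_pair {β : ℝ} (hβ : 0 < β) (κ : ℝ) (Q' : Set (Plaquette 3 L))
    {f₁ f₂ : GaugeConfig 3 L SU2 → ℝ} (h₁ : IsPhys f₁) (h₂ : IsPhys f₂)
    (hn₁ : l2 f₁ f₁ = 1) (hn₂ : l2 f₂ f₂ = 1) (horth : l2 f₁ f₂ = 0) {m ε : ℝ}
    (hm : ∀ a b : ℝ, m * (a ^ 2 + b ^ 2) ≤ qform su2Rep β (a • f₁ + b • f₂) (a • f₁ + b • f₂))
    (hε : ∀ a b : ℝ, l2 ({U : GaugeConfig 3 L SU2 | ¬ ∃ p ∈ Q',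
        β ^ (κ - 1) < 2 - (su2Rep (plaquetteHolonomy U p.1 p.2.1.1 p.2.1.2)).trace.re}ᶜ.indicator (a • f₁ + b • f₂))
      ({U : GaugeConfig 3 L SU2 | ¬ ∃ p ∈ Q',
        β ^ (κ - 1) < 2 - (su2Rep (plaquetteHolonomy U p.1 p.2.1.1 p.2.1.2)).trace.re}ᶜ.indicator (a • f₁ + b • f₂)) ≤
        ε * (a ^ 2 + b ^ 2))
    (hε1 : ε < 1) (hεm : topValue su2Rep L β * ε ≤ m) :
    (Real.sqrt m - Real.sqrt (topValue su2Rep L β * ε)) ^ 2 ≤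
      sInf {x : ℝ | ∃ φ : GaugeConfig 3 L SU2 → ℝ, IsPhys φ ∧ x = sSup (rayleighSet su2Rep L β fun ψ =>
        (∀ U : GaugeConfig 3 L SU2,
          (∃ p ∈ Q', β ^ (κ - 1) < 2 - (su2Rep (plaquetteHolonomy U p.1 p.2.1.1 p.2.1.2)).trace.re) → ψ U = 0) ∧
        l2 ψ φ = 0)} := by
  refine le_compressedSecond_of_cut_pair hβ.le h₁ h₂ (fun f hf => wallCutoffs_isPhys (β ^ (κ - 1)) Q' hf) ?_ hn₁ hn₂ horth hm hε hε1 hεm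
  intro a b U hU
  exact Set.indicator_of_notMem (fun h : U ∈ {U : GaugeConfig 3 L SU2 | ¬ ∃ p ∈ Q',
    β ^ (κ - 1) < 2 - (su2Rep (plaquetteHolonomy U p.1 p.2.1.1 p.2.1.2)).trace.re} => h hU) _

end Summit.QuantumFields.YangMills.Theorems.FemtoTransferGap.SFCompression

end
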